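import Literature.AlgebraicGeometry.Morphisms.ProperCoherentCohomologyFiniteOverRing
import Literature.AlgebraicGeometry.Modules.HomologySheafSections
import Literature.AlgebraicGeometry.Modules.HigherDirectImageRestrictOpen
import Literature.AlgebraicGeometry.Modules.DerivedPushforwardAmplitude
import Literature.AlgebraicGeometry.Modules.CechPushforward
import Literature.AlgebraicGeometry.Morphisms.ProperPushforwardCoh
import Mathlib.AlgebraicGeometry.Morphisms.Proper
import HarnessLib

/-!
# Higher direct images of a coherent sheaf under a proper morphism to an AFFINE noetherian base:
# quasi-coherence and finiteness of global sections (EGA III 3.2.1 / Görtz–Wedhorn II Thm. 23.17 over `Spec A`;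
# Hartshorne III Prop. 8.5, Thm. 8.8)

Layer `Literature/AlgebraicGeometry/Morphisms`. For `g : X → B` with a finite cover `𝓤` of `X` whose faces are
affine over `B` (e.g. `g` proper, `B` affine: `X` is then quasi-compact and separated) and an affine-localizing
`𝒪_X`-module `G`, the derived direct image `Rg_*(G[0])` (`Modules/DerivedPushforward`) is the class of the
direct image of the ordered Čech complex (`Modules/DerivedPushforwardAmplitude`), so its cohomology sheaves are
the homology sheaves of a complex of affine-localizing `𝒪_B`-modules (`Modules/CechPushforward`):

* §1 `cechModel g U G`, `nonempty_homology_iso_cechModel` — `𝓗ᵏ(Rg_*(G[0])) ≅ Hᵏ(g_* Č•_ord(𝓤, G)⁺)`;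
  `isAffineLocalizing_cechModel_X`; **`isAffineLocalizing_homology_derivedPushforwardPlus_single`** — the
  higher direct images are affine-localizing (= quasi-coherent) (Hartshorne III Prop. 8.5 / Cor. 8.6);
  `isZero_homology_derivedPushforwardPlus_single_of_neg` (`k < 0`).
* §2 `sectionsTopFunctor B : B.Modules ⥤ ModuleCat Γ(B, ⊤)` and, for `B` AFFINE with noetherian ring of global
  sections, `g` PROPER and `G` COHERENT, **`module_finite_sections_top_homology_derivedPushforwardPlus_single`**:
  `Γ(B, 𝓗ᵏ(Rg_*(G[0])))` is a finitely generated `Γ(B, 𝒪_B)`-module for every `k` — by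
  `Modules/HomologySheafSections` (`Γ(B, Hᵏ) = Hᵏ(Γ(B, –))` on the affine `B`), the cochain dictionary
  `CechOrd.homTopAddEquiv`, ordered Leray `CechOrd.extUnitAddEquivHomologySucc` on `X`, the transfer
  `Algebra/Homology/HomologyAddEquivTransfer`, and Görtz–Wedhorn II Cor. 23.18 over the affine noetherian base
  (`Morphisms/ProperCoherentCohomologyFiniteOverRing.module_finite_ext_unit_of_isProper`, at
  `Over.mk (g ≫ B.isoSpec.hom)`), `Γ(B, 𝒪_B)`-semilinearly through naturality; degree `0` through
  `Γ(X, G)` (`FormalFunctionsModuleComplete.moduleFinite_msections_of_coh`).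

Everything PROVED; 0 named facts; no instances. §1 at `Scheme.{u}`; §2 at `Scheme.{0}` (the universe of
`…FiniteOverRing` §4). Step E₁ of the discharge of `Modules/BoundedCoherentVBModels.Grothendieck_higherDirectImage_coh`
(EGA III 3.2.1); the localisation to an affine base is `Modules/HigherDirectImageRestrictOpen`. Nothing here bears on
any summit statement.

## References

* A. Grothendieck, J. Dieudonné, EGA III (Publ. Math. IHÉS 11, 1961), Thm. 3.2.1, Prop. 1.4.10–1.4.11. [EGAIII1]
* U. Görtz, T. Wedhorn, *Algebraic Geometry II* (2023), Thm. 22.9, Thm. 23.17, Cor. 23.18 (pp. 424–425). [GortzWedhorn2023]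
* R. Hartshorne, *Algebraic Geometry*, GTM 52 (1977), III Prop. 8.5, Cor. 8.6, Thm. 8.8 (pp. 251–252). [Hartshorne1977]
* The Stacks Project, Tags 01XD, 02KE, 02O5. [StacksProject]
-/

noncomputable section

-- `TopCat.Presheaf`/`Scheme.Modules` are not reducible (as in Mathlib's `AlgebraicGeometry/Modules/Sheaf.lean`).
set_option backward.isDefEq.respectTransparency false

open CategoryTheory CategoryTheory.Limits CategoryTheory.Abelian AlgebraicGeometry TopologicalSpace Opposite
open AlgebraicGeometry.Scheme.Modules

universe w w' u

namespace Literature.AlgebraicGeometry.Morphisms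

open Literature.AlgebraicGeometry.Modules Literature.Algebra.Homology

/-! ## §1 The Čech model of `Rg_*(G[0])` and the quasi-coherence of its cohomology sheaves -/

section Model

variable {X B : Scheme.{u}} (g : X ⟶ B) {ι : Type u} [LinearOrder ι] [Fintype ι] (U : ι → X.Opens)
  (hcov : ⨆ i, U i = ⊤) (hUaff : ∀ {m : ℕ} (α : Fin (m + 1) → ι), IsAffineHom ((face U α).ι ≫ g)) (G : X.Modules)

/-- **The Čech model** `g_* Č•_ord(𝓤, G)⁺ ∈ C⁺(Mod 𝒪_B)` of `Rg_*(G[0])`. [cite: Hartshorne1977, III Prop. 8.7 (proof)] -/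
abbrev cechModel : CochainComplex.Plus B.Modules :=
  (pushforward g).mapCochainComplexPlus.obj (plusOfNat (CechOrd.complex U G))

include hUaff in
/-- The terms `g_*(Č•_ord(𝓤, G)⁺)ᵏ` of the Čech model are affine-localizing (`k ≥ 0`: `g_* Čᵏ_ord`,
`Modules/CechPushforward.isAffineLocalizing_pushforward_obj` for the family of `k`-faces; `k < 0`: zero).
[cite: Hartshorne1977, II Prop. 5.8 (c)] [cite: StacksProject, Tag 02KE] -/
theorem isAffineLocalizing_cechModel_X (hG : IsAffineLocalizing G) (k : ℤ) :
    IsAffineLocalizing ((cechModel g U G).obj.X k) := by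
  change IsAffineLocalizing ((pushforward g).obj (((CechOrd.complex U G).extend ComplexShape.embeddingUpNat).X k))
  by_cases hk : 0 ≤ k
  · obtain ⟨n, rfl⟩ := Int.eq_ofNat_of_zero_le hk
    haveI : Finite (CechOrd.Simplex ι n) := Finite.of_fintype _
    exact IsAffineLocalizing.of_iso ((pushforward g).mapIso
      ((CechOrd.complex U G).extendXIso ComplexShape.embeddingUpNat (i := n) rfl).symm)
      (Cech.isAffineLocalizing_pushforward_obj g (CechOrd.faces U n) 0
        (fun β => CechOrd.isAffineHom_face_faces_ι_comp U g (fun α => hUaff α) β) hG)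
  · refine IsAffineLocalizing.of_isZero ((pushforward g).map_isZero
      ((CechOrd.complex U G).isZero_extend_X ComplexShape.embeddingUpNat k fun n hn => hk ?_))
    rw [← hn]; exact Int.natCast_nonneg n

variable [HasDerivedCategory.{w} X.Modules] [HasDerivedCategory.{w'} B.Modules]

include hcov hUaff in
/-- **`𝓗ᵏ(Rg_*(G[0])) ≅ Hᵏ(g_* Č•_ord(𝓤, G)⁺)`** for `G` affine-localizing and a finite cover with faces affine over
`B`. [cite: Hartshorne1977, III Prop. 8.7] [cite: StacksProject, Tag 02KE] -/
theorem nonempty_homology_iso_cechModel (hG : IsAffineLocalizing G) (k : ℤ) :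
    Nonempty ((DerivedCategory.Plus.homologyFunctor B.Modules k).obj
        ((derivedPushforwardPlus g).obj ((DerivedCategory.Plus.singleFunctor X.Modules 0).obj G)) ≅
      (cechModel g U G).obj.homology k) := by
  obtain ⟨e⟩ := nonempty_derivedPushforwardPlus_single_iso_cechOrd g U hcov (fun α => hUaff α) hG
  exact ⟨(DerivedCategory.Plus.homologyFunctor B.Modules k).mapIso e ≪≫ plusHomologyFunctorQObjIso _ k⟩

include hcov hUaff in
/-- **The higher direct images `𝓗ᵏ(Rg_*(G[0]))` are affine-localizing (quasi-coherent)** for `G`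
affine-localizing, whenever `X` has a finite cover with faces affine over `B` (Hartshorne III Prop. 8.5 /
Cor. 8.6: homology sheaves of the complex of quasi-coherent modules `g_* Č•_ord`, `Modules/HomologySheafSections`).
[cite: Hartshorne1977, III Cor. 8.6 (p. 251)] [cite: StacksProject, Tag 02KE] -/
theorem isAffineLocalizing_homology_derivedPushforwardPlus_single (hG : IsAffineLocalizing G) (k : ℤ) :
    IsAffineLocalizing ((DerivedCategory.Plus.homologyFunctor B.Modules k).obj
      ((derivedPushforwardPlus g).obj ((DerivedCategory.Plus.singleFunctor X.Modules 0).obj G))) := by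
  obtain ⟨e⟩ := nonempty_homology_iso_cechModel g U hcov hUaff G hG k
  exact IsAffineLocalizing.of_iso e.symm
    (isAffineLocalizing_homology _ (isAffineLocalizing_cechModel_X g U hUaff G hG) k)

include hcov hUaff in
/-- `𝓗ᵏ(Rg_*(G[0])) = 0` for `k < 0` (the Čech model lives in degrees `≥ 0`). [cite: Hartshorne1977, III Prop. 8.1] -/
theorem isZero_homology_derivedPushforwardPlus_single_of_neg (hG : IsAffineLocalizing G) {k : ℤ} (hk : k < 0) :
    IsZero ((DerivedCategory.Plus.homologyFunctor B.Modules k).obj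
      ((derivedPushforwardPlus g).obj ((DerivedCategory.Plus.singleFunctor X.Modules 0).obj G))) := by
  obtain ⟨e⟩ := nonempty_homology_iso_cechModel g U hcov hUaff G hG k
  refine IsZero.of_iso ?_ e
  refine ShortComplex.isZero_homology_of_isZero_X₂ _ ((pushforward g).map_isZero
    ((CechOrd.complex U G).isZero_extend_X ComplexShape.embeddingUpNat k fun n hn => ?_))
  rw [ComplexShape.embeddingUpNat_f] at hn
  omega

end Model

/-! ## §2 Global sections of the higher direct images over an affine noetherian base are finite -/

section SectionsComplex

variable {Y : Scheme.{u}} (L : CochainComplex Y.Modules ℤ) (V : Y.Opens)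

/-- **The complex of sections `Γ(V, L•)`** of a cochain complex of `𝒪_Y`-modules over an open `V`, a complex of
`Γ(V, 𝒪_Y)`-modules. [cite: Hartshorne1977, III Prop. 8.5 (p. 251)] -/
def sectionsComplex : CochainComplex (ModuleCat.{u} Γ(Y, V)) ℤ where
  X m := ModuleCat.of _ Γ(L.X m, V)
  d m m' := ModuleCat.ofHom (appLinear (L.d m m') V)
  shape m m' h := by
    ext x
    change (L.d m m').app V x = 0
    rw [L.shape m m' h, Scheme.Modules.Hom.zero_app]
    rfl
  d_comp_d' m₁ m₂ m₃ _ _ := by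
    ext x
    change (L.d m₂ m₃).app V ((L.d m₁ m₂).app V x) = 0
    exact app_app_eq_zero (ShortComplex.mk (L.d m₁ m₂) (L.d m₂ m₃) (L.d_comp_d m₁ m₂ m₃)) V x

/-- The terms of `sectionsComplex` (definitional). [cite: Hartshorne1977, III Prop. 8.5 (p. 251)] -/
theorem sectionsComplex_X (m : ℤ) : (sectionsComplex L V).X m = ModuleCat.of Γ(Y, V) Γ(L.X m, V) := rfl

/-- The differentials of `sectionsComplex` are the section maps of the differentials (definitional).
[cite: Hartshorne1977, III Prop. 8.5 (p. 251)] -/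
theorem sectionsComplex_d_apply (m m' : ℤ) (x : Γ(L.X m, V)) :
    ((sectionsComplex L V).d m m').hom x = (L.d m m').app V x := rfl

end SectionsComplex

section SectionsTop

variable {X B : Scheme.{0}} (g : X ⟶ B) {ι : Type} [LinearOrder ι] [Fintype ι] (U : ι → X.Opens)
  (hcov : ⨆ i, U i = ⊤) (hUaff : ∀ {m : ℕ} (α : Fin (m + 1) → ι), IsAffineHom ((face U α).ι ≫ g))
  (hUa : ∀ s : Finset ι, s.Nonempty → IsAffineOpen (CechOrd.faceSet U s)) (G : X.Modules)

/-- Sections over `⊤` of an `𝒪`-module that is a zero object form a finite module. [folklore: private helper] -/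
private theorem module_finite_sections_of_isZero {Y : Scheme.{u}} {M : Y.Modules} (hM : IsZero M) (V : Y.Opens) :
    Module.Finite Γ(Y, V) Γ(M, V) := by
  have h0 : ∀ x : Γ(M, V), x = 0 := fun x => by
    have h := hM.eq_of_src (𝟙 M) 0
    calc x = (𝟙 M : M ⟶ M).app V x := by rw [Scheme.Modules.Hom.id_app]; rfl
      _ = 0 := by rw [h, Scheme.Modules.Hom.zero_app]; rfl
  exact Module.Finite.of_surjective (0 : Γ(Y, V) →ₗ[Γ(Y, V)] Γ(M, V)) fun x => ⟨0, by rw [h0 x, map_zero]⟩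

include hcov hUaff in
/-- **Degree `0`**: `Γ(B, H⁰(g_* Č•_ord⁺))` is a quotient of the finite `Γ(B, 𝒪_B)`-module `Γ(B, g_*G) = Γ(X, G)`
(`Morphisms/ProperPushforwardCoh`): every `0`-cocycle of sections comes from the augmentation `G → Č⁰_ord`.
[cite: GortzWedhorn2023, Thm. 23.17 (p. 424)] [cite: Hartshorne1977, III Prop. 8.5 (p. 251)] -/
theorem module_finite_sections_top_homology_cechModel_zero [IsAffine B] [IsProper g] [IsLocallyNoetherian B]
    (hG : Coh G) : Module.Finite Γ(B, ⊤) Γ((cechModel g U G).obj.homology 0, ⊤) := by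
  let L := (cechModel g U G).obj
  let C := CechOrd.complex U G
  let aug := CechOrd.exactAugmentation U G hcov
  -- the augmentation `g_*G → L⁰ = g_*((Č•)⁺)⁰`, which lands in the `0`-cycles
  let ε₀ : (C.extend ComplexShape.embeddingUpNat).X 0 ≅ C.X 0 := C.extendXIso ComplexShape.embeddingUpNat (i := 0) rfl
  let ε₁ : (C.extend ComplexShape.embeddingUpNat).X 1 ≅ C.X 1 := C.extendXIso ComplexShape.embeddingUpNat (i := 1) rfl
  have hd : (C.extend ComplexShape.embeddingUpNat).d 0 1 = ε₀.hom ≫ C.d 0 1 ≫ ε₁.inv :=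
    C.extend_d_eq ComplexShape.embeddingUpNat rfl rfl
  let a : (pushforward g).obj G ⟶ L.X 0 := (pushforward g).map (aug.ε ≫ ε₀.inv)
  have ha : a ≫ L.d 0 1 = 0 := by
    change (pushforward g).map (aug.ε ≫ ε₀.inv) ≫ (pushforward g).map ((C.extend ComplexShape.embeddingUpNat).d 0 1) = 0
    rw [← Functor.map_comp, hd, Category.assoc, ε₀.inv_hom_id_assoc, ← Category.assoc, aug.ε_d, zero_comp,
      Functor.map_zero]
  let Φ : (pushforward g).obj G ⟶ L.homology 0 := L.liftCycles a 1 (by simp [CochainComplex.next]) ha ≫ L.homologyπ 0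
  -- `Γ(B, g_*G)` is finite (Görtz–Wedhorn II Thm. 23.17, i = 0)
  haveI : IsLocallyNoetherian X := LocallyOfFiniteType.isLocallyNoetherian g
  haveI : Module.Finite Γ(B, ⊤) Γ((pushforward g).obj G, ⊤) :=
    moduleFinite_app_pushforward_of_isProper g hG (isAffineOpen_top B)
  refine Module.Finite.of_surjective (appLinear Φ ⊤) fun h => ?_
  -- surjectivity: a section of `H⁰` lifts to a `0`-cycle, i.e. a `0`-cocycle of `Č•_ord`, i.e. a section of `G`
  have hLX := isAffineLocalizing_cechModel_X g U hUaff G hG.loc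
  obtain ⟨z, rfl⟩ := homologyπ_app_surjective hLX 0 (isAffineOpen_top B) h
  let x : Γ(L.X 0, ⊤) := (L.iCycles 0).app ⊤ z
  have hx : (L.d 0 1).app ⊤ x = 0 := d_app_iCycles_app L 0 1 ⊤ z
  -- `y = ε₀ x` is a `0`-cocycle of `Č•_ord(𝓤, G)` over `X`
  let y : Γ(C.X 0, ⊤) := ε₀.hom.app ⊤ x
  have hy : (C.d 0 1).app ⊤ y = 0 := by
    have h1 : (L.d 0 1).app ⊤ x = ε₁.inv.app ⊤ ((C.d 0 1).app ⊤ (ε₀.hom.app ⊤ x)) := by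
      change ((pushforward g).map ((C.extend ComplexShape.embeddingUpNat).d 0 1)).app ⊤ x = _
      rw [hd]
      rfl
    rw [hx] at h1
    have h2 := congrArg (ε₁.hom.app ⊤) h1
    rw [map_zero, hom_app_inv_app] at h2
    exact h2.symm
  haveI := aug.mono_ε
  obtain ⟨s, hs⟩ := (sections_exact_of_exact_of_mono aug.exact₀ ⊤).2 y hy
  refine ⟨s, ?_⟩
  -- `Φ s = π₀ (lift s)` and `lift s = z` since both have image `x` under the injective `ι_Z`
  have hlift : (L.liftCycles a 1 (by simp [CochainComplex.next]) ha).app ⊤ s = z := by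
    apply iCycles_app_injective L 0 ⊤
    change (L.liftCycles a 1 (by simp [CochainComplex.next]) ha ≫ L.iCycles 0).app ⊤ s = x
    rw [HomologicalComplex.liftCycles_i]
    change ε₀.inv.app ⊤ (aug.ε.app ⊤ s) = x
    have hs' : aug.ε.app ⊤ s = y := hs
    rw [hs', inv_app_hom_app]
  change (L.liftCycles a 1 (by simp [CochainComplex.next]) ha ≫ L.homologyπ 0).app ⊤ s = (L.homologyπ 0).app ⊤ z
  rw [Scheme.Modules.Hom.comp_app, CategoryTheory.comp_apply, hlift]

set_option maxHeartbeats 400000 in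
include hcov hUaff hUa in
/-- **Positive degrees**: `Γ(B, Hⁿ⁺¹(g_* Č•_ord⁺))` is finite over `A = Γ(B, 𝒪_B)` for `g` proper, `B` affine noetherian,
`G` coherent — ordered Leray on `X` (`Extⁿ⁺¹(𝒪_X, G) ≃+ Hⁿ⁺¹(Č•_ord)`), the transfer to the complex of sections
(`HomologyAddEquivTransfer`), Görtz–Wedhorn II Cor. 23.18 over `A` (`…FiniteOverRing`), and `Γ(B, Hⁿ⁺¹) = Hⁿ⁺¹(Γ(B, –))`
(`HomologySheafSections`); `A`-semilinearity through the naturality of the Leray isomorphism (`φ = a • 𝟙_G`).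
[cite: GortzWedhorn2023, Thm. 23.17 with proof and Cor. 23.18 (pp. 424–425); Thm. 22.9 (p. 332)] [cite: EGAIII1, Thm. 3.2.1] -/
theorem module_finite_sections_top_homology_cechModel_succ [IsAffine B] [IsProper g] [IsLocallyNoetherian B]
    (hG : Coh G) (n : ℕ) : Module.Finite Γ(B, ⊤) Γ((cechModel g U G).obj.homology (n + 1), ⊤) := by
  classical
  -- the `A`-scheme structure `X → B ≅ Spec A`, `A = Γ(B, 𝒪_B)`
  let X'' : Over (Spec (CommRingCat.of Γ(B, ⊤))) := Over.mk (g ≫ B.isoSpec.hom)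
  haveI : IsProper X''.hom := inferInstanceAs (IsProper (g ≫ B.isoSpec.hom))
  haveI : IsNoetherianRing Γ(B, ⊤) := IsLocallyNoetherian.component_noetherian ⟨⊤, isAffineOpen_top B⟩
  have hsc : ∀ c : Γ(B, ⊤), scalarRingHomTop X'' c = g.appTop c := fun c => by
    rw [scalarRingHomTop_apply]
    change (g ≫ B.isoSpec.hom).appTop _ = _
    rw [Scheme.Hom.comp_appTop, Scheme.isoSpec, asIso_hom, Scheme.toSpecΓ_appTop, CategoryTheory.comp_apply]
    change g.appTop ((Scheme.ΓSpecIso Γ(B, ⊤)).hom ((Scheme.ΓSpecIso Γ(B, ⊤)).inv c)) = g.appTop c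
    rw [Iso.inv_hom_id_apply]
  -- the complexes
  let C := CechOrd.complex U G
  let L := (cechModel g U G).obj
  let K : CochainComplex AddCommGrpCat.{1} ℕ := CechOrd.homComplex U G
  let L' := sectionsComplex L ⊤
  let ε : ∀ m : ℕ, (C.extend ComplexShape.embeddingUpNat).X m ≅ C.X m := fun m =>
    C.extendXIso ComplexShape.embeddingUpNat (i := m) rfl
  have hLd : ∀ m : ℕ, L.d (m : ℤ) ((m + 1 : ℕ) : ℤ) =
      (pushforward g).map ((ε m).hom ≫ C.d m (m + 1) ≫ (ε (m + 1)).inv) := fun m => by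
    change (pushforward g).map ((C.extend ComplexShape.embeddingUpNat).d (m : ℤ) ((m + 1 : ℕ) : ℤ)) = _
    rw [C.extend_d_eq ComplexShape.embeddingUpNat (show ComplexShape.embeddingUpNat.f m = (m : ℤ) from rfl)
      (show ComplexShape.embeddingUpNat.f (m + 1) = ((m + 1 : ℕ) : ℤ) from rfl)]
  -- the cochain dictionary `Ext⁰(𝒪_X, Čᵐ) ≃+ Γ(B, g_*((Č•)⁺)ᵐ)`
  let e₂ : ∀ m : ℕ, Γ(C.X m, ⊤) ≃+ Γ((C.extend ComplexShape.embeddingUpNat).X m, ⊤) := fun m =>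
    { toFun := (ε m).inv.app ⊤
      invFun := (ε m).hom.app ⊤
      left_inv := fun x => hom_app_inv_app (ε m) ⊤ x
      right_inv := fun x => inv_app_hom_app (ε m) ⊤ x
      map_add' := fun x y => map_add _ x y }
  let e : ∀ m : ℕ, (K.X m : Type 1) ≃+ (L'.X (m : ℤ) : Type) := fun m =>
    (CechOrd.homTopAddEquiv U G m).trans (e₂ m)
  have he : ∀ (m : ℕ) (x : K.X m),
      e (m + 1) ((K.d m (m + 1)).hom x) = (L'.d (m : ℤ) ((m + 1 : ℕ) : ℤ)).hom (e m x) := by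
    intro m x
    change (ε (m + 1)).inv.app ⊤ (CechOrd.homTopAddEquiv U G (m + 1) (((CechOrd.homComplex U G).d m (m + 1)).hom x)) =
      (L.d (m : ℤ) ((m + 1 : ℕ) : ℤ)).app ⊤ ((ε m).inv.app ⊤ (CechOrd.homTopAddEquiv U G m x))
    rw [CechOrd.homTopAddEquiv_d, hLd m, pushforward_map_app]
    change _ = ((ε m).hom ≫ C.d m (m + 1) ≫ (ε (m + 1)).inv).app ⊤ ((ε m).inv.app ⊤ _)
    rw [Scheme.Modules.Hom.comp_app, Scheme.Modules.Hom.comp_app, CategoryTheory.comp_apply,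
      CategoryTheory.comp_apply, hom_app_inv_app, CechOrd.complex_d]
    rfl
  -- `Ext ≃+ Hⁿ⁺¹(K) ≃+ Hⁿ⁺¹(L')`
  let E := CechOrd.extUnitAddEquivHomologySucc U G hUa hcov hG.loc n
  let T := HomologyTransfer.homologyAddEquiv e he n
  let f : Ext.{1} (unitModule X''.left) G (n + 1) ≃+ (L'.homology ((n + 1 : ℕ) : ℤ) : Type) := E.trans T
  -- `A`-linearity
  -- the two scalar actions on `Γ(B, g_*E) = Γ(X, E)` agree: `c • t = g♯(c) • t`
  have hsmul : ∀ (E' : X.Modules) (c : Γ(B, ⊤)) (t : Γ(E', ⊤)),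
      (c • (show Γ((pushforward g).obj E', ⊤) from t) : Γ((pushforward g).obj E', ⊤)) =
        (show Γ((pushforward g).obj E', ⊤) from g.appTop c • t) := fun _ _ _ => rfl
  letI : Linear (Γ(B, ⊤) : Type) X.Modules := instLinearOverBase X''
  have hf : ∀ (c : Γ(B, ⊤)) (x : Ext.{1} (unitModule X''.left) G (n + 1)), f (c • x) = c • f x := by
    intro c x
    let φ : G ⟶ G := c • 𝟙 G
    let ψ : K ⟶ K := AcyclicResolution.extComplexMap (unitModule X) (CechOrd.mapComplex U φ)
    have h1 : E (c • x) = (HomologicalComplex.homologyMap ψ (n + 1)).hom (E x) := by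
      rw [Ext.smul_eq_comp_mk₀]
      exact (CechOrd.extUnitAddEquivHomologySucc_naturality U φ hUa hcov hG.loc hG.loc n x).symm
    have hψ : ∀ (m : ℕ) (y : K.X m), e m ((ψ.f m).hom y) = c • e m y := by
      intro m y
      -- on cochains, `ψ` is multiplication by the global function `g♯(c)`
      have hcoch : CechOrd.homTopAddEquiv U G m ((ψ.f m).hom y) = g.appTop c • CechOrd.homTopAddEquiv U G m y := by
        funext β
        rw [CechOrd.homTopAddEquiv_map, Cech.obj_smul_apply]
        change ((show Γ(X, ⊤) from scalarRingHomTop X'' c) • 𝟙 G).app _ _ = _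
        rw [smul_app_apply, Scheme.Modules.Hom.id_app]
        change X.presheaf.map _ (scalarRingHomTop X'' c) • _ = _
        rw [hsc]
        rfl
      have hstep : (ε m).inv.app ⊤ (CechOrd.homTopAddEquiv U G m ((ψ.f m).hom y)) =
          g.appTop c • (ε m).inv.app ⊤ (CechOrd.homTopAddEquiv U G m y) := by
        rw [hcoch, Scheme.Modules.Hom.app_smul]
      exact hstep.trans (hsmul _ c _).symm
    have h2 := HomologyTransfer.homologyAddEquiv_homologyMap_of_smul e he hψ n (E x)
    change T (E (c • x)) = c • T (E x)
    rw [h1, h2]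
  -- finiteness of `Ext` (Cor. 23.18 over `A`), carried to `Hⁿ⁺¹(L')`
  haveI : Module.Finite Γ(B, ⊤) (Ext.{1} (unitModule X''.left) G (n + 1)) :=
    module_finite_ext_unit_of_isProper X'' G hG (n + 1)
  haveI : Module.Finite Γ(B, ⊤) (L'.homology ((n + 1 : ℕ) : ℤ)) :=
    Module.Finite.of_addEquiv_semilinear (RingHom.id _) Function.surjective_id f.symm (fun c y => by
      apply f.injective
      rw [AddEquiv.apply_symm_apply, hf, AddEquiv.apply_symm_apply]
      rfl)
  -- `Hⁿ⁺¹(L') = ker/im` maps onto `Γ(B, Hⁿ⁺¹(L))`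
  haveI : Module.Finite Γ(B, ⊤) (HomologyTransfer.scL L' n).moduleCatLeftHomologyData.H :=
    Module.Finite.equiv (HomologyTransfer.isoL L' n).toLinearEquiv
  have hLX := isAffineLocalizing_cechModel_X g U hUaff G hG.loc
  -- the lift `ker d^{n+1}(Γ) → Γ(B, Z^{n+1}) → Γ(B, H^{n+1})`
  have hprev : (ComplexShape.up ℤ).prev ((n + 1 : ℕ) : ℤ) = (n : ℤ) := by rw [CochainComplex.prev]; push_cast; ring
  have hnext : (ComplexShape.up ℤ).next ((n + 1 : ℕ) : ℤ) = ((n + 2 : ℕ) : ℤ) := by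
    rw [CochainComplex.next]; push_cast; ring
  have hlift : ∀ x : LinearMap.ker (HomologyTransfer.scL L' n).g.hom,
      ∃! z : Γ(L.cycles ((n + 1 : ℕ) : ℤ), ⊤), (L.iCycles _).app ⊤ z = x.1 := fun x => by
    obtain ⟨z, hz⟩ := exists_iCycles_app_eq L ((n + 1 : ℕ) : ℤ) ((n + 2 : ℕ) : ℤ) hnext ⊤ x.1 x.2
    exact ⟨z, hz, fun z' hz' => iCycles_app_injective L _ ⊤ (hz'.trans hz.symm)⟩
  choose lift hlift_eq hlift_uniq using hlift
  have lift_spec : ∀ (x : LinearMap.ker (HomologyTransfer.scL L' n).g.hom) (z : Γ(L.cycles ((n + 1 : ℕ) : ℤ), ⊤)),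
      (L.iCycles _).app ⊤ z = x.1 → lift x = z := fun x z hz => (hlift_uniq x z hz).symm
  let ψ₀ : LinearMap.ker (HomologyTransfer.scL L' n).g.hom →ₗ[Γ(B, ⊤)] Γ(L.homology ((n + 1 : ℕ) : ℤ), ⊤) :=
    { toFun := fun x => (L.homologyπ _).app ⊤ (lift x)
      map_add' := fun x y => by
        rw [← map_add]
        congr 1
        exact lift_spec (x + y) _ (by rw [map_add, hlift_eq, hlift_eq]; rfl)
      map_smul' := fun c x => by
        rw [RingHom.id_apply, ← Scheme.Modules.Hom.app_smul]
        congr 1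
        exact lift_spec (c • x) _ (by rw [Scheme.Modules.Hom.app_smul, hlift_eq]; rfl) }
  have hψ₀ : ∀ y : (HomologyTransfer.scL L' n).X₁,
      ψ₀ ((HomologyTransfer.scL L' n).moduleCatToCycles y) = 0 := fun y => by
    change (L.homologyπ _).app ⊤ (lift _) = 0
    rw [lift_spec _ ((L.toCycles (n : ℤ) ((n + 1 : ℕ) : ℤ)).app ⊤ y) (iCycles_app_toCycles_app L _ _ ⊤ y)]
    exact homologyπ_app_toCycles_app L _ _ ⊤ y
  let Ψ : (HomologyTransfer.scL L' n).moduleCatLeftHomologyData.H →ₗ[Γ(B, ⊤)]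
      Γ(L.homology ((n + 1 : ℕ) : ℤ), ⊤) :=
    (LinearMap.range (HomologyTransfer.scL L' n).moduleCatToCycles).liftQ ψ₀ (by
      rintro _ ⟨y, rfl⟩
      exact hψ₀ y)
  refine Module.Finite.of_surjective Ψ fun h => ?_
  obtain ⟨z, rfl⟩ := homologyπ_app_surjective hLX ((n + 1 : ℕ) : ℤ) (isAffineOpen_top B) h
  let x : LinearMap.ker (HomologyTransfer.scL L' n).g.hom :=
    ⟨(L.iCycles _).app ⊤ z, d_app_iCycles_app L _ _ ⊤ z⟩
  refine ⟨Submodule.Quotient.mk x, ?_⟩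
  change ψ₀ x = _
  change (L.homologyπ _).app ⊤ (lift x) = _
  rw [lift_spec x z rfl]

include hcov hUaff hUa in
/-- **Görtz–Wedhorn II Thm. 23.17 / EGA III 3.2.1 over an affine base, in global sections**: for `g : X → B` proper,
`B` affine with noetherian local rings (`IsLocallyNoetherian B`), `G` coherent and every `k`, `Γ(B, 𝓗ᵏ(Rg_*(G[0])))` is
a finitely generated `Γ(B, 𝒪_B)`-module (given a finite cover of `X` with affine finite intersections whose faces are
affine over `B` — any finite affine cover, `X` being separated). [cite: GortzWedhorn2023, Thm. 23.17 (p. 424)] [cite: EGAIII1, Thm. 3.2.1] -/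
theorem module_finite_sections_top_homology_of_cover [IsAffine B] [IsProper g] [IsLocallyNoetherian B]
    [HasDerivedCategory.{w} X.Modules] [HasDerivedCategory.{w'} B.Modules] (hG : Coh G) (k : ℤ) :
    Module.Finite Γ(B, ⊤) Γ((DerivedCategory.Plus.homologyFunctor B.Modules k).obj
      ((derivedPushforwardPlus g).obj ((DerivedCategory.Plus.singleFunctor X.Modules 0).obj G)), ⊤) := by
  obtain ⟨e⟩ := nonempty_homology_iso_cechModel g U hcov hUaff G hG.loc k
  suffices h : Module.Finite Γ(B, ⊤) Γ((cechModel g U G).obj.homology k, ⊤) from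
    Module.Finite.of_surjective (appLinear e.inv ⊤) fun x => ⟨e.hom.app ⊤ x, inv_app_hom_app e ⊤ x⟩
  by_cases hk : 0 ≤ k
  · obtain ⟨n, rfl⟩ := Int.eq_ofNat_of_zero_le hk
    cases n with
    | zero => exact module_finite_sections_top_homology_cechModel_zero g U hcov hUaff G hG
    | succ n => exact module_finite_sections_top_homology_cechModel_succ g U hcov hUaff hUa G hG n
  · refine module_finite_sections_of_isZero (ShortComplex.isZero_homology_of_isZero_X₂ _
      ((pushforward g).map_isZero ((CechOrd.complex U G).isZero_extend_X ComplexShape.embeddingUpNat k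
        fun n hn => hk ?_))) ⊤
    rw [← hn]; exact Int.natCast_nonneg n

end SectionsTop

/-! ## §3 Over an affine noetherian base: the statements -/

section Affine

variable {X B : Scheme.{0}} (g : X ⟶ B) [IsAffine B] [IsProper g] [IsLocallyNoetherian B]
  [HasDerivedCategory.{w} X.Modules] [HasDerivedCategory.{w'} B.Modules] (G : X.Modules)

omit [IsLocallyNoetherian B] [HasDerivedCategory.{w} X.Modules] [HasDerivedCategory.{w'} B.Modules] in
/-- A finite affine cover of the source of a proper morphism to an affine scheme, with affine finite
intersections, whose faces are affine over the base. [cite: Hartshorne1977, III Prop. 8.7 (proof)] -/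
private theorem exists_cover :
    ∃ (ι : Type) (_ : Fintype ι) (_ : LinearOrder ι) (U : ι → X.Opens), (⨆ i, U i = ⊤) ∧
      (∀ {m : ℕ} (α : Fin (m + 1) → ι), IsAffineHom ((face U α).ι ≫ g)) ∧
      ∀ s : Finset ι, s.Nonempty → IsAffineOpen (CechOrd.faceSet U s) := by
  haveI : CompactSpace X := QuasiCompact.compactSpace_of_compactSpace g
  haveI : X.IsSeparated := by
    rw [Scheme.isSeparated_iff, ← terminal.comp_from g]; infer_instance
  let 𝒰 := X.affineCover.finiteSubcover
  letI : Fintype 𝒰.I₀ := Fintype.ofFinite _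
  letI : LinearOrder 𝒰.I₀ := LinearOrder.lift' (Fintype.equivFin 𝒰.I₀) (Fintype.equivFin 𝒰.I₀).injective
  have hUi : ∀ i, IsAffineOpen (𝒰.f i).opensRange := fun i => isAffineOpen_opensRange (𝒰.f i)
  refine ⟨𝒰.I₀, inferInstance, inferInstance, fun i => (𝒰.f i).opensRange, 𝒰.iSup_opensRange, fun β => ?_,
    fun s hs => IsAffineOpen.biInf (s : Set 𝒰.I₀) s.finite_toSet hs fun i _ => hUi i⟩
  have hface : IsAffineOpen (face (fun i => (𝒰.f i).opensRange) β) := IsAffineOpen.iInf fun k => hUi (β k)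
  haveI : IsAffine (face (fun i => (𝒰.f i).opensRange) β) := hface
  haveI : IsAffineHom (((face (fun i => (𝒰.f i).opensRange) β).ι ≫ g) ≫ terminal.from B) := inferInstance
  exact IsAffineHom.of_comp (g := terminal.from B) _

omit [IsLocallyNoetherian B] in
/-- **The higher direct images over an affine base are affine-localizing (quasi-coherent)** — `g : X → B` proper,
`B` affine, `G` coherent. [cite: Hartshorne1977, III Cor. 8.6 (p. 251)] [cite: EGAIII1, Prop. 1.4.10] -/
theorem isAffineLocalizing_homology_derivedPushforwardPlus_single_of_isAffine (hG : Coh G) (k : ℤ) :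
    IsAffineLocalizing ((DerivedCategory.Plus.homologyFunctor B.Modules k).obj
      ((derivedPushforwardPlus g).obj ((DerivedCategory.Plus.singleFunctor X.Modules 0).obj G))) := by
  obtain ⟨ι, _, _, U, hcov, hUaff, -⟩ := exists_cover g
  exact isAffineLocalizing_homology_derivedPushforwardPlus_single g U hcov hUaff G hG.loc k

/-- **Görtz–Wedhorn II Thm. 23.17 / EGA III 3.2.1 over an affine base**: for `g : X → B` proper, `B` affine locally
noetherian, `G` coherent and every `k`, `Γ(B, 𝓗ᵏ(Rg_*(G[0])))` is a finitely generated `Γ(B, 𝒪_B)`-module.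
[cite: GortzWedhorn2023, Thm. 23.17 (p. 424) and Cor. 23.18] [cite: EGAIII1, Thm. 3.2.1] -/
theorem module_finite_sections_top_homology_derivedPushforwardPlus_single (hG : Coh G) (k : ℤ) :
    Module.Finite Γ(B, ⊤) Γ((DerivedCategory.Plus.homologyFunctor B.Modules k).obj
      ((derivedPushforwardPlus g).obj ((DerivedCategory.Plus.singleFunctor X.Modules 0).obj G)), ⊤) := by
  obtain ⟨ι, _, _, U, hcov, hUaff, hUa⟩ := exists_cover g
  exact module_finite_sections_top_homology_of_cover g U hcov hUaff hUa G hG k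

end Affine

end Literature.AlgebraicGeometry.Morphisms

end
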